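import Summits.CriticalPhenomena.SAWScalingLimit.Theorems.SAWRenewalTightnessShellCrossingBoundSplit

/-!
# `ShellCrossingBound` / `EventualTight`: the summit-safe split glue with an ARBITRARY interior collar

Companion of `SAWRenewalTightnessShellCrossingBoundSplit.lean` (`Theorems.ShellCrossingBound_of_subs`, collar `2R`).
Crux items stmt-CriticalPhenomena-4728 (`ShellCrossingBound`) and stmt-CriticalPhenomena-1372 (`EventualTight`,
line `Sketch` v5), and the `birth` skeletons of the twins stmt-4922 / stmt-1881, which select INTERIOR shells by
different collars (`B̄(x, 3R) ⊆ Ω`, resp. `B̄(x, R) ⊆ Ω`).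

**Theorem `ShellCrossingBound_of_subs_collar`:** for every `C ≥ 1`, restriction positivity
(`ConfinementPositivity`) together with per-shell tightness of the traversal count on the shells `D(y; η, R)`
with `B̄(y, C·R) ⊆ Ω` gives `ShellCrossingBound`.  For `C ≥ 2` the bulk hypothesis is WEAKER than
`BulkShellTight` (fewer shells), so this is the form every interior atom can feed, whatever its collar.

Proof: verbatim the proof of `ShellCrossingBound_of_subs` (good middle circle `exists_good_mid`; socketed
enlargement `stub_socketedEnlargement` with collar `ε₀`; nesting; Sub₁ for the pair `D ⊆ D̂`; a net of `M`
points on the middle circle; for each net point either an empty event or an interior small shell of `D̂`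
bounded by the bulk hypothesis and transferred by restriction covariance; net pigeonhole
`exists_netPoint_hasTraversals`; union bound; `shellCrossing_of_perShellDecay`), with ONE change: the small
shells have outer radius `R′ ≤ ε₀/(2C)` (instead of `ε₀/4`), so that `B̄(yᵢ, C R′) ⊆ B̄(z, (C+1) R′) ⊆ B̄(z, ε₀)
⊆ D̂` for the point `z ∈ Ω̄` within `η < R′` of `yᵢ`.
[cite: AizenmanBurchardDuke1999, §1.b and Lemma 3.1] [cite: LawlerSchrammWerner2004SAW, §3]
-/

noncomputable section
open MeasureTheory Set Metric Filter Topology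
open scoped unitInterval ENNReal Real
open Literature.Probability.RandomPlanarGeometry Literature.Probability.LatticeModels

namespace Summit.CriticalPhenomena.SAWScalingLimit.Theorems

/-- **The split glue with an arbitrary interior collar `C ≥ 1`:** as `ShellCrossingBound_of_subs`, but the
bulk hypothesis is only asked on shells `D(y; η, R)` with `B̄(y, C·R) ⊆ Ω` (for `C ≥ 2` a WEAKER hypothesis than
`BulkShellTight`; `C = 3` is the scale-invariant collar of the line `birth` of stmt-4922, whose virginization glue
needs `B̄(x, 2R + δ) ⊆ Ω`).  Same proof: the small shells of the net are chosen with `R′ ≤ ε₀/(2C)`, so that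
`B̄(yᵢ, C R′) ⊆ B̄(z, (C+1)R′) ⊆ B̄(z, ε₀) ⊆ D̂`.
[cite: AizenmanBurchardDuke1999, §1.b and Lemma 3.1] [cite: LawlerSchrammWerner2004SAW, §3] -/
theorem ShellCrossingBound_of_subs_collar :
    ∀ C : ℝ, 1 ≤ C →
    (∀ (D D' : DobrushinDomain) (a b : ℝ → Site 2) (d : ℝ), 0 < d →
      D'.carrier ⊆ D.carrier → D'.pt 0 = D.pt 0 → D'.pt 1 = D.pt 1 →
      D.carrier ∩ (Metric.ball (D.pt 0) d ∪ Metric.ball (D.pt 1) d) ⊆ D'.carrier →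
      SAW.IsEndpointApprox D' a b →
        ∃ c δ₀ : ℝ, 0 < c ∧ 0 < δ₀ ∧ ∀ δ ∈ Set.Ioc (0 : ℝ) δ₀,
          ENNReal.ofReal c ≤ SAW.law D.carrier δ (a δ) (b δ)
            {γ | ∃ γ' : SAW.DomainSAW D'.carrier δ (a δ) (b δ),
              γ'.walk.support = γ.walk.support}) →
    (∀ (D : DobrushinDomain) (a b : ℝ → Site 2), SAW.IsEndpointApprox D a b →
      ∀ (y : ℂ) (η R : ℝ), 0 < η → η < R → Metric.closedBall y (C * R) ⊆ D.carrier →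
        ∀ ε : ℝ, 0 < ε → ∃ (j : ℕ) (δ₁ : ℝ), 0 < δ₁ ∧ ∀ δ ∈ Set.Ioc (0 : ℝ) δ₁,
          SAW.law D.carrier δ (a δ) (b δ)
            {γ | (⟨γ.walk.toCurve (meshPoint δ)⟩ : Curve ℂ).HasTraversals j y η R} ≤
            ENNReal.ofReal ε) →
    Summit.CriticalPhenomena.SAWScalingLimit.Theses.SAWRenewalTightness.ShellCrossingBound := by
  intro C hC hE hB D a b hab
  classical
  refine shellCrossing_of_perShellDecay D a b fun x ρ R hρ hρR ε hε => ?_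
  /- (1) a good middle radius and its sub-shell -/
  obtain ⟨m, hm1, hm2, hfa, hfb⟩ := exists_good_mid hρR (dist (D.pt 0) x) (dist (D.pt 1) x)
  set w : ℝ := (R - ρ) / 3 with hw_def
  have hw : 0 < w := by rw [hw_def]; linarith
  have h6 : (R - ρ) / 6 = w / 2 := by rw [hw_def]; ring
  have hρm : ρ + w / 2 ≤ m := by linarith
  have hmR : m + w / 2 ≤ R := by linarith
  have hmpos : 0 < m := by linarith
  set ρ₁ : ℝ := m - w / 2 with hρ₁_def
  set R₁ : ℝ := m + w / 2 with hR₁_def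
  have hρρ₁ : ρ ≤ ρ₁ := by rw [hρ₁_def]; linarith
  have hR₁R : R₁ ≤ R := by rw [hR₁_def]; linarith
  have hρ₁m : ρ₁ < m := by rw [hρ₁_def]; linarith
  have hmR₁ : m < R₁ := by rw [hR₁_def]; linarith
  /- (2) the socketed enlargement at `d = w/8 = (R - ρ)/24`, nesting, confinement -/
  set d : ℝ := w / 8 with hd_def
  have hd : 0 < d := by positivity
  have h2d : 2 * d = (R - ρ) / 12 := by rw [hd_def, hw_def]; ring
  obtain ⟨D', ε₀, hε₀, hsub, hpt0, hpt1, hsock, hroom⟩ := stub_socketedEnlargement D d hd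
  obtain ⟨δ₃, hδ₃, hnest⟩ :=
    D.toJordanDomain.exists_forall_meshDomain_subset D'.toJordanDomain hsub
  have hN : ∀ δ : ℝ, 0 < δ → δ ≤ δ₃ → ∀ {u v : Site 2} (γ' : SAW.DomainSAW D.carrier δ u v),
      ∃ γ : SAW.DomainSAW D'.carrier δ u v, γ.walk.support = γ'.walk.support :=
    fun δ hδ hδ' _ _ γ' => exists_domainSAW_of_meshDomain_subset hsub (hnest δ hδ hδ') γ'
  -- `(a_δ, b_δ)` is an endpoint approximation of the enlargement as well
  have hab' : SAW.IsEndpointApprox D' a b := by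
    refine ⟨?_, ?_, ?_⟩
    · filter_upwards [hab.reachable, Ioc_mem_nhdsGT hδ₃] with δ hr hδ
      obtain ⟨p⟩ := hr
      obtain ⟨γ, -⟩ := hN δ hδ.1 hδ.2 ⟨p.bypass, p.bypass_isPath⟩
      exact γ.walk.reachable
    · rw [hpt0]; exact hab.tendsto_fst
    · rw [hpt1]; exact hab.tendsto_snd
  -- confinement positivity for the pair `D ⊆ D̂` with sockets of radius `d/2`
  have hsock' : D'.carrier ∩ (ball (D'.pt 0) (d / 2) ∪ ball (D'.pt 1) (d / 2)) ⊆ D.carrier := by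
    rw [hpt0, hpt1]; exact hsock
  obtain ⟨c, δ₂, hc, hδ₂, hconf⟩ :=
    hE D' D a b (d / 2) (by positivity) hsub hpt0.symm hpt1.symm hsock' hab
  /- (3) radii of the small shells, resolution and size of the net -/
  have hCpos : 0 < C := lt_of_lt_of_le one_pos hC
  set R' : ℝ := min (w / 4) (ε₀ / (2 * C)) with hR'_def
  have hR' : 0 < R' := lt_min (by positivity) (by positivity)
  have hR'w : R' ≤ w / 4 := min_le_left _ _
  have hR'ε : R' ≤ ε₀ / (2 * C) := min_le_right _ _
  -- the collar fits: `(C + 1) R' ≤ ε₀`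
  have hcollar : C * R' + R' ≤ ε₀ := by
    have h1 : C * R' + R' ≤ (C + 1) * (ε₀ / (2 * C)) := by nlinarith
    have h2 : (C + 1) * (ε₀ / (2 * C)) ≤ ε₀ := by
      rw [← sub_nonneg]
      have h3 : ε₀ - (C + 1) * (ε₀ / (2 * C)) = ε₀ * (C - 1) / (2 * C) := by
        field_simp
        ring
      rw [h3]
      exact div_nonneg (mul_nonneg hε₀.le (by linarith)) (by positivity)
    linarith
  set η₀ : ℝ := min R' d / 2 with hη₀_def
  have hmin : 0 < min R' d := lt_min hR' hd
  have hη₀ : 0 < η₀ := by rw [hη₀_def]; positivity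
  have hη₀R' : η₀ < R' := by
    have := min_le_left R' d
    rw [hη₀_def]; linarith
  have hη₀d : η₀ < d := by
    have := min_le_right R' d
    rw [hη₀_def]; linarith
  set M : ℕ := ⌈2 * π * m / η₀⌉₊ + 1 with hM_def
  have hM1 : 1 ≤ M := by omega
  have hMpos : (0 : ℝ) < M := by exact_mod_cast (show 0 < M by omega)
  have hMgt : 2 * π * m / η₀ < M := by
    have h1 := Nat.le_ceil (2 * π * m / η₀)
    have h2 : (M : ℝ) = (⌈2 * π * m / η₀⌉₊ : ℝ) + 1 := by rw [hM_def]; push_cast; ring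
    rw [h2]
    linarith
  set η : ℝ := 2 * π * m / M with hη_def
  have hη : 0 < η := by rw [hη_def]; positivity
  have hηη₀ : η < η₀ := by
    rw [hη_def, div_lt_iff₀ hMpos]
    have h1 := (div_lt_iff₀ hη₀).1 hMgt
    linarith [mul_comm (M : ℝ) η₀]
  have hηR' : η < R' := hηη₀.trans hη₀R'
  have hηd : η ≤ d := (hηη₀.trans hη₀d).le
  -- the net points
  let N : ℕ → ℂ := fun i => x + (m : ℂ) * Complex.exp (((-π + 2 * π * i / M : ℝ) : ℂ) * Complex.I)
  have hNdist : ∀ i, dist (N i) x = m := fun i => by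
    show dist (x + (m : ℂ) * Complex.exp (((-π + 2 * π * i / M : ℝ) : ℂ) * Complex.I)) x = m
    rw [dist_eq_norm, add_sub_cancel_left, norm_mul, Complex.norm_real, Real.norm_eq_abs,
      abs_of_nonneg hmpos.le, Complex.norm_exp_ofReal_mul_I, mul_one]
  -- the net points are `2d = (R - ρ)/12` away from the marked points
  have hfar : ∀ (p : ℂ) (i : ℕ), (R - ρ) / 12 ≤ |dist p x - m| → 2 * d ≤ dist (N i) p := by
    intro p i hp
    have h1 := abs_dist_sub_le p (N i) x
    rw [hNdist i] at h1
    rw [dist_comm, h2d]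
    linarith
  /- (4) the bound at each net point: empty event, or an interior shell of `D̂` transferred to `D` -/
  set ε' : ℝ := ε / M with hε'_def
  have hε' : 0 < ε' := div_pos hε hMpos
  have key : ∀ i : Fin M, ∃ (j : ℕ) (δi : ℝ), 0 < δi ∧ ∀ δ ∈ Set.Ioc (0 : ℝ) δi,
      SAW.law D.carrier δ (a δ) (b δ)
        {γ | (⟨γ.walk.toCurve (meshPoint δ)⟩ : Curve ℂ).HasTraversals j (N i) η R'} ≤
        ENNReal.ofReal ε' := by
    intro i
    by_cases hA : ∃ z ∈ closure D.carrier, dist z (N i) ≤ η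
    · obtain ⟨z, hz, hzy⟩ := hA
      -- `z` is `d`-far from the marked points
      have hz0 : d ≤ dist z (D.pt 0) := by
        have h1 := hfar (D.pt 0) i hfa
        have h2 := dist_triangle (N i) z (D.pt 0)
        rw [dist_comm] at hzy
        linarith
      have hz1 : d ≤ dist z (D.pt 1) := by
        have h1 := hfar (D.pt 1) i hfb
        have h2 := dist_triangle (N i) z (D.pt 1)
        rw [dist_comm] at hzy
        linarith
      -- the ball `B̄(N i, C R')` is interior in `D̂`
      have hball : closedBall (N i) (C * R') ⊆ D'.carrier := by
        refine (closedBall_subset_closedBall' ?_).trans (hroom z hz hz0 hz1)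
        rw [dist_comm] at hzy
        linarith
      obtain ⟨j, δF, hδF, hbig⟩ :=
        hB D' a b hab' (N i) η R' hη hηR' hball (ε' * c) (mul_pos hε' hc)
      refine ⟨j, min δF (min δ₂ δ₃), lt_min hδF (lt_min hδ₂ hδ₃), fun δ hδ => ?_⟩
      have hδF' : δ ∈ Set.Ioc (0 : ℝ) δF := ⟨hδ.1, hδ.2.trans (min_le_left _ _)⟩
      have hδ2 : δ ∈ Set.Ioc (0 : ℝ) δ₂ :=
        ⟨hδ.1, hδ.2.trans ((min_le_right _ _).trans (min_le_left _ _))⟩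
      have hδ3 : δ ≤ δ₃ := hδ.2.trans ((min_le_right _ _).trans (min_le_right _ _))
      have hcov : SAW.law D.carrier δ (a δ) (b δ)
            {γ | (⟨γ.walk.toCurve (meshPoint δ)⟩ : Curve ℂ).HasTraversals j (N i) η R'} *
          SAW.law D'.carrier δ (a δ) (b δ)
            {γ | ∃ γ' : SAW.DomainSAW D.carrier δ (a δ) (b δ),
              γ'.walk.support = γ.walk.support} ≤
          SAW.law D'.carrier δ (a δ) (b δ)
            {γ | (⟨γ.walk.toCurve (meshPoint δ)⟩ : Curve ℂ).HasTraversals j (N i) η R'} :=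
        SAW.law_mul_law_setOf_exists_support_eq_le (hN δ hδ.1 hδ3)
          {γc : Curve ℂ | γc.HasTraversals j (N i) η R'}
      have hprod : SAW.law D.carrier δ (a δ) (b δ)
            {γ | (⟨γ.walk.toCurve (meshPoint δ)⟩ : Curve ℂ).HasTraversals j (N i) η R'} *
          ENNReal.ofReal c ≤ ENNReal.ofReal (ε' * c * 1) :=
        calc SAW.law D.carrier δ (a δ) (b δ)
                {γ | (⟨γ.walk.toCurve (meshPoint δ)⟩ : Curve ℂ).HasTraversals j (N i) η R'} *
              ENNReal.ofReal c
            ≤ SAW.law D.carrier δ (a δ) (b δ)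
                {γ | (⟨γ.walk.toCurve (meshPoint δ)⟩ : Curve ℂ).HasTraversals j (N i) η R'} *
              SAW.law D'.carrier δ (a δ) (b δ)
                {γ | ∃ γ' : SAW.DomainSAW D.carrier δ (a δ) (b δ),
                  γ'.walk.support = γ.walk.support} := mul_le_mul' le_rfl (hconf δ hδ2)
          _ ≤ SAW.law D'.carrier δ (a δ) (b δ)
                {γ | (⟨γ.walk.toCurve (meshPoint δ)⟩ : Curve ℂ).HasTraversals j (N i) η R'} := hcov
          _ ≤ ENNReal.ofReal (ε' * c) := hbig δ hδF'
          _ = ENNReal.ofReal (ε' * c * 1) := by rw [mul_one]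
      have hdiv := le_ofReal_div_mul_of_mul_ofReal_le hc hprod
      have hcalc : ε' * c / c * 1 = ε' := by field_simp
      rwa [hcalc] at hdiv
    · -- no point of `Ω̄` within `η` of the net point: no polyline traverses the small shell
      refine ⟨1, 1, one_pos, fun δ hδ => ?_⟩
      have hempty : {γ : SAW.DomainSAW D.carrier δ (a δ) (b δ) |
          (⟨γ.walk.toCurve (meshPoint δ)⟩ : Curve ℂ).HasTraversals 1 (N i) η R'} = ∅ :=
        Set.eq_empty_iff_forall_notMem.2 fun γ hγ =>
          hA (exists_mem_closure_of_hasTraversals γ.walk one_ne_zero hηR' hγ)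
      rw [hempty, measure_empty]
      exact bot_le
  choose j δi hδi hbound using key
  /- (5) thresholds, net pigeonhole and the union bound -/
  haveI : NeZero M := ⟨by omega⟩
  set J : ℕ := Finset.univ.sup j with hJ_def
  have hjJ : ∀ i, j i ≤ J := fun i => Finset.le_sup (f := j) (Finset.mem_univ i)
  set δ₁ : ℝ := Finset.univ.inf' Finset.univ_nonempty δi with hδ₁_def
  have hδ₁ : 0 < δ₁ := (Finset.lt_inf'_iff _).2 fun i _ => hδi i
  have hδ₁le : ∀ i, δ₁ ≤ δi i := fun i => Finset.inf'_le _ (Finset.mem_univ i)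
  refine ⟨M * J + 1, δ₁, hδ₁, fun δ hδ => ?_⟩
  -- the event inclusion
  have hsubev : {γ : SAW.DomainSAW D.carrier δ (a δ) (b δ) |
        (⟨γ.walk.toCurve (meshPoint δ)⟩ : Curve ℂ).HasTraversals (M * J + 1) x ρ R} ⊆
      ⋃ i : Fin M, {γ | (⟨γ.walk.toCurve (meshPoint δ)⟩ : Curve ℂ).HasTraversals (j i) (N i) η R'} := by
    intro γ hγ
    have h1 : (⟨γ.walk.toCurve (meshPoint δ)⟩ : Curve ℂ).HasTraversals (M * J + 1) x ρ₁ R₁ :=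
      Curve.HasTraversals.mono' hγ hρρ₁ hR₁R
    have hin : R' ≤ m - ρ₁ := by rw [hρ₁_def]; linarith
    have hout : R' ≤ R₁ - m := by rw [hR₁_def]; linarith
    obtain ⟨i, hiM, htrav⟩ := exists_netPoint_hasTraversals hρ₁m hmR₁ hmpos hin hout hM1 h1
    refine Set.mem_iUnion.2 ⟨⟨i, hiM⟩, ?_⟩
    have hle : j ⟨i, hiM⟩ ≤ J + 1 := (hjJ ⟨i, hiM⟩).trans (Nat.le_succ J)
    exact Curve.HasTraversals.of_le htrav hle
  calc SAW.law D.carrier δ (a δ) (b δ) {γ : SAW.DomainSAW D.carrier δ (a δ) (b δ) |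
          (⟨γ.walk.toCurve (meshPoint δ)⟩ : Curve ℂ).HasTraversals (M * J + 1) x ρ R}
      ≤ SAW.law D.carrier δ (a δ) (b δ)
          (⋃ i : Fin M, {γ | (⟨γ.walk.toCurve (meshPoint δ)⟩ : Curve ℂ).HasTraversals (j i) (N i) η R'}) :=
        measure_mono hsubev
    _ ≤ ∑ i : Fin M, SAW.law D.carrier δ (a δ) (b δ)
          {γ | (⟨γ.walk.toCurve (meshPoint δ)⟩ : Curve ℂ).HasTraversals (j i) (N i) η R'} :=
        measure_iUnion_fintype_le _ _
    _ ≤ ∑ _i : Fin M, ENNReal.ofReal ε' :=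
        Finset.sum_le_sum fun i _ => hbound i δ ⟨hδ.1, hδ.2.trans (hδ₁le i)⟩
    _ = ENNReal.ofReal (M * ε') := by
        rw [Finset.sum_const, Finset.card_univ, Fintype.card_fin, nsmul_eq_mul,
          ENNReal.ofReal_mul (Nat.cast_nonneg M), ENNReal.ofReal_natCast]
    _ = ENNReal.ofReal ε := by
        congr 1
        rw [hε'_def]
        field_simp



end Summit.CriticalPhenomena.SAWScalingLimit.Theorems

end
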